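import Summits.RiemannHypothesis.RiemannHypothesis.Theorems.MotivicDoorFfWeilConverse
import Summits.RiemannHypothesis.RiemannHypothesis.Theorems.PfPersistenceFfWeilCriterion

/-!
# Motivic door, function-field side (C)(i), part 3: the DICTIONARY between the two typings of "honest"
(pub-rhdoor seat ff-1; dedup repair requested by rh-director 2026-08-19T17:36:14Z, MAP §5 D1.  HONEST FRAMING:
lottery ticket at the motivic door; RH probability negligible; consolation prizes are real.  No claim about `ζ`;
"RH(q,h)" is `|α| = √q` for the roots of one integer polynomial.)

Two kernel files state the converse Weil criterion for the window tower under different spellings of the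
functional equation of the datum `(q,h)`:
* ff-1 (`MotivicDoorFfWeilConverse`, 90089b740e0c): COEFFICIENT form `q^g c_j = q^i c_i (i + j = 2g)`, `natDegree h = 2g`;
* pub-rhpf ffmirror-2 (`PfPersistenceFfWeilCriterion`, 4f1b3da6ffbf — the citation of record for the equivalence and
  its sharp finite depth): ROOT form `(frobRoots h).map (q/·) = frobRoots h` (as MULTISETS) and `0 ∉ frobRoots h`.
This file proves COEFFICIENT form ⇒ ROOT form at the multiset level (`frobRoots_map_reciprocal`; the membership
level and `0 ∉ roots` are part 1's `frobRoots_reciprocal` / `frobRoots_ne_zero`), via root multiplicities: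
`reflect (2g) (p ∘ (q·X)) = q^g · p` (the FE as a polynomial identity, `reflect_comp_eq_of_fe`) transports
`(X - b)^m ∣ p` to `(X - q/b)^m ∣ p` (`rootMultiplicity_eq_reciprocal`).  Consequence: coefficient-FE honest data
inherit ffmirror-2's finite-depth criterion — `weilWindowForm_posSemidef_lastWindow_iff_ffRH`:
`T_{2g-1}(q,h) ⪰ 0 ↔ RH(q,h)` — so the door theorems of part 2 may read "all windows PSD" as "the window of
depth 2g − 1 is PSD". [folklore throughout]
-/

set_option linter.dupNamespace false

noncomputable section

open Polynomial
open scoped ComplexOrder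

open Summit.RiemannHypothesis.RiemannHypothesis.Theorems.PfPersistence.FfAngleTwin

namespace Summit.RiemannHypothesis.RiemannHypothesis.Theorems.MotivicDoor.FunctionField

/-! ## Reflection and scaling transport divisibility by powers of linear factors -/

/-- `reflect m ((X - b)^m) = (1 - bX)^m`. [folklore] -/
theorem reflect_X_sub_C_pow (b : ℂ) (m : ℕ) : reflect m ((X - C b) ^ m) = (1 - C b * X) ^ m := by
  induction m with
  | zero => simp
  | succ m ih =>
    have hdeg : ((X - C b) ^ m).natDegree ≤ m := by
      rw [natDegree_pow, natDegree_X_sub_C, mul_one]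
    rw [pow_succ, reflect_mul _ _ hdeg (natDegree_X_sub_C_le b), ih, reflect_sub, reflect_one_X, reflect_C,
      pow_one, pow_succ]

/-- Reflection turns a factor `(X - b)^m`, `b ≠ 0`, into a factor `(X - b⁻¹)^m`. [folklore] -/
theorem X_sub_C_inv_pow_dvd_reflect {f : ℂ[X]} {N m : ℕ} (hf : f.natDegree ≤ N) {b : ℂ} (hb : b ≠ 0)
    (hdvd : (X - C b) ^ m ∣ f) : (X - C b⁻¹) ^ m ∣ reflect N f := by
  obtain ⟨r, rfl⟩ := hdvd
  by_cases hr : r = 0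
  · simp [hr]
  have hlin : ((X - C b) ^ m).natDegree = m := by rw [natDegree_pow, natDegree_X_sub_C, mul_one]
  have hprod := hf
  rw [natDegree_mul (pow_ne_zero _ (X_sub_C_ne_zero b)) hr, hlin] at hprod
  rw [show N = m + (N - m) by omega, reflect_mul _ _ hlin.le (by omega), reflect_X_sub_C_pow]
  refine Dvd.dvd.mul_right (pow_dvd_pow_of_dvd ⟨C (-b), ?_⟩ m) _
  rw [C_neg, mul_neg, sub_mul, ← C_mul, inv_mul_cancel₀ hb, C_1]
  ring

/-- Scaling `X ↦ cX`, `c ≠ 0`, turns a factor `(X - b)^m` into a factor `(X - b/c)^m`. [folklore] -/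
theorem X_sub_C_div_pow_dvd_comp {f : ℂ[X]} {m : ℕ} {b c : ℂ} (hc : c ≠ 0) (hdvd : (X - C b) ^ m ∣ f) :
    (X - C (b / c)) ^ m ∣ f.comp (C c * X) := by
  obtain ⟨r, rfl⟩ := hdvd
  rw [mul_comp, pow_comp, sub_comp, X_comp, C_comp]
  refine Dvd.dvd.mul_right (pow_dvd_pow_of_dvd ⟨C c, ?_⟩ m) _
  rw [sub_mul, ← C_mul, div_mul_cancel₀ b hc]
  ring

/-! ## The functional equation as a polynomial identity, and multiplicities -/

/-- COEFFICIENT FE ⇒ `reflect (2g) (p(qX)) = q^g · p` for `p = h ⊗ ℂ` (i.e. `x^{2g} p(q/x) = q^g p(x)`). [folklore] -/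
theorem reflect_comp_eq_of_fe {q : ℕ} {h : ℤ[X]} {g : ℕ} (hdeg : h.natDegree = 2 * g)
    (hFE : ∀ i j, i + j = 2 * g → (q : ℤ) ^ g * h.coeff j = (q : ℤ) ^ i * h.coeff i) :
    reflect (2 * g) ((h.map (Int.castRingHom ℂ)).comp (C (q : ℂ) * X))
      = C ((q : ℂ) ^ g) * h.map (Int.castRingHom ℂ) := by
  ext i
  rw [coeff_reflect, comp_C_mul_X_coeff, coeff_C_mul]
  by_cases hi : i ≤ 2 * g
  · rw [revAt_le hi, fe_complex hFE (i := 2 * g - i) (j := i) (by omega), mul_comm]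
  · have hlt : 2 * g < i := not_le.1 hi
    have hz : (h.map (Int.castRingHom ℂ)).coeff i = 0 := by
      rw [coeff_map, coeff_eq_zero_of_natDegree_lt (by omega), map_zero]
    rw [revAt_eq_self_of_lt hlt, hz, zero_mul, mul_zero]

/-- MULTIPLICITIES ARE RECIPROCAL-SYMMETRIC: under the coefficient FE, `mult_b(p) ≤ mult_{q/b}(p)` for `b ≠ 0`.
[folklore] -/
theorem rootMultiplicity_le_reciprocal {q : ℕ} (hq : 0 < q) {h : ℤ[X]} {g : ℕ} (hdeg : h.natDegree = 2 * g)
    (hFE : ∀ i j, i + j = 2 * g → (q : ℤ) ^ g * h.coeff j = (q : ℤ) ^ i * h.coeff i) {b : ℂ} (hb : b ≠ 0) :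
    rootMultiplicity b (h.map (Int.castRingHom ℂ)) ≤
      rootMultiplicity ((q : ℂ) / b) (h.map (Int.castRingHom ℂ)) := by
  set p : ℂ[X] := h.map (Int.castRingHom ℂ) with hp
  by_cases hp0 : p = 0
  · simp [hp0]
  have hqC : (q : ℂ) ≠ 0 := by exact_mod_cast hq.ne'
  have hpdeg : p.natDegree ≤ 2 * g := by rw [hp, ← hdeg]; exact natDegree_map_le
  have hcdeg : (p.comp (C (q : ℂ) * X)).natDegree ≤ 2 * g := by
    refine (natDegree_le_iff_coeff_eq_zero).2 fun i hi => ?_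
    rw [comp_C_mul_X_coeff, coeff_eq_zero_of_natDegree_lt (lt_of_le_of_lt hpdeg (by exact_mod_cast hi)),
      zero_mul]
  -- (X - b)^m ∣ p ⇒ (X - b/q)^m ∣ p(qX) ⇒ (X - q/b)^m ∣ reflect (2g) (p(qX)) = q^g p ⇒ (X - q/b)^m ∣ p
  have h1 := X_sub_C_div_pow_dvd_comp hqC (pow_rootMultiplicity_dvd p b)
  have h2 := X_sub_C_inv_pow_dvd_reflect hcdeg (div_ne_zero hb hqC) h1
  rw [inv_div, reflect_comp_eq_of_fe hdeg hFE, ← hp] at h2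
  have hunit : IsUnit (C ((q : ℂ) ^ g)) := isUnit_C.2 (IsUnit.mk0 _ (pow_ne_zero _ hqC))
  exact (le_rootMultiplicity_iff hp0).2 (hunit.dvd_mul_left.1 h2)

/-- … hence `mult_b(p) = mult_{q/b}(p)` for `b ≠ 0`. [folklore] -/
theorem rootMultiplicity_eq_reciprocal {q : ℕ} (hq : 0 < q) {h : ℤ[X]} {g : ℕ} (hdeg : h.natDegree = 2 * g)
    (hFE : ∀ i j, i + j = 2 * g → (q : ℤ) ^ g * h.coeff j = (q : ℤ) ^ i * h.coeff i) {b : ℂ} (hb : b ≠ 0) :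
    rootMultiplicity ((q : ℂ) / b) (h.map (Int.castRingHom ℂ)) =
      rootMultiplicity b (h.map (Int.castRingHom ℂ)) := by
  have hqC : (q : ℂ) ≠ 0 := by exact_mod_cast hq.ne'
  refine le_antisymm ?_ (rootMultiplicity_le_reciprocal hq hdeg hFE hb)
  have := rootMultiplicity_le_reciprocal hq hdeg hFE (b := (q : ℂ) / b) (div_ne_zero hqC hb)
  rwa [div_div_cancel₀ hqC] at this

/-- THE DICTIONARY (multiset level): the coefficient FE closes the root multiset under `α ↦ q/α` WITH
MULTIPLICITIES — ffmirror-2's hypothesis `hrec`. [folklore] -/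
theorem frobRoots_map_reciprocal {q : ℕ} (hq : 0 < q) {h : ℤ[X]} {g : ℕ} (hdeg : h.natDegree = 2 * g)
    (hFE : ∀ i j, i + j = 2 * g → (q : ℤ) ^ g * h.coeff j = (q : ℤ) ^ i * h.coeff i) :
    (frobRoots h).map (fun α => (q : ℂ) / α) = frobRoots h := by
  classical
  have hqC : (q : ℂ) ≠ 0 := by exact_mod_cast hq.ne'
  set f : ℂ → ℂ := fun α => (q : ℂ) / α with hf
  have hinv : ∀ α, f (f α) = α := by
    intro α
    by_cases hα : α = 0
    · simp [hf, hα]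
    · simp only [hf]; rw [div_div_cancel₀ hqC]
  have hinj : Function.Injective f := fun x y hxy => by simpa [hinv] using congrArg f hxy
  ext a
  calc Multiset.count a ((frobRoots h).map f)
        = Multiset.count (f (f a)) ((frobRoots h).map f) := by rw [hinv]
    _ = Multiset.count (f a) (frobRoots h) := Multiset.count_map_eq_count' f _ hinj (f a)
    _ = Multiset.count a (frobRoots h) := by
        simp only [frobRoots, count_roots, hf]
        by_cases ha : a = 0
        · simp [ha]
        · exact rootMultiplicity_eq_reciprocal hq hdeg hFE ha

/-- ffmirror-2's second hypothesis from the coefficient FE: `0 ∉ frobRoots h`. [folklore] -/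
theorem zero_not_mem_frobRoots {q : ℕ} (hq : 0 < q) {h : ℤ[X]} {g : ℕ} (hdeg : h.natDegree = 2 * g)
    (hFE : ∀ i j, i + j = 2 * g → (q : ℤ) ^ g * h.coeff j = (q : ℤ) ^ i * h.coeff i) :
    (0 : ℂ) ∉ frobRoots h :=
  fun h0 => frobRoots_ne_zero hq hdeg hFE 0 h0 rfl

/-! ## Consequence: the finite-depth criterion for coefficient-FE honest data (via ffmirror-2, 4f1b3da6ffbf) -/

/-- ONE WINDOW DECIDES (ffmirror-2's `weilWindowForm_posSemidef_iff`, re-keyed to the coefficient FE): for an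
honest datum of degree `2g` and any depth `M ≥ 2g - 1`, `T_M(q,h) ⪰ 0 ↔ RH(q,h)`. [folklore] -/
theorem weilWindowForm_posSemidef_depth_iff_ffRH {q : ℕ} (hq : 0 < q) {h : ℤ[X]} {g : ℕ}
    (hdeg : h.natDegree = 2 * g)
    (hFE : ∀ i j, i + j = 2 * g → (q : ℤ) ^ g * h.coeff j = (q : ℤ) ^ i * h.coeff i)
    {M : ℕ} (hM : 2 * g ≤ M + 1) :
    (weilWindowForm (q : ℝ) h M).PosSemidef ↔ ∀ α ∈ frobRoots h, ‖α‖ = Real.sqrt q := by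
  have hrec : (frobRoots h).map (fun α => ((q : ℝ) : ℂ) / α) = frobRoots h := by
    simpa only [Complex.ofReal_natCast] using frobRoots_map_reciprocal hq hdeg hFE
  exact weilWindowForm_posSemidef_iff (by exact_mod_cast hq) hrec (zero_not_mem_frobRoots hq hdeg hFE)
    (by rw [hdeg]; exact hM)

/-- THE LAST INFORMATIVE WINDOW DECIDES: `T_{2g-1}(q,h) ⪰ 0 ↔ RH(q,h)` for an honest datum of dimension `g ≥ 1`
(ffmirror-2's `weilWindowForm_posSemidef_twoG_iff`, coefficient-FE keyed). [folklore] -/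
theorem weilWindowForm_posSemidef_lastWindow_iff_ffRH {q : ℕ} (hq : 0 < q) {h : ℤ[X]} {g : ℕ} (hg : 1 ≤ g)
    (hdeg : h.natDegree = 2 * g)
    (hFE : ∀ i j, i + j = 2 * g → (q : ℤ) ^ g * h.coeff j = (q : ℤ) ^ i * h.coeff i) :
    (weilWindowForm (q : ℝ) h (2 * g - 1)).PosSemidef ↔ ∀ α ∈ frobRoots h, ‖α‖ = Real.sqrt q :=
  weilWindowForm_posSemidef_depth_iff_ffRH hq hdeg hFE (by omega)

end Summit.RiemannHypothesis.RiemannHypothesis.Theorems.MotivicDoor.FunctionField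

end
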